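import Mathlib
import Summits.CriticalPhenomena.CardyFormulaZ2.Theorems.CardySelfRefinementGradientComparabilityStubNonAxialShareBulkSurgery
import Literature.Probability.Percolation.PlanarDuality
import HarnessLib

/-!
# Local surgery around a pivotal axial edge: frames, drawn detours, and level 1

Helper file for the stub `stub_nonAxialShare_bulk` (D4-bulk) of the line `Sketch` (crux
`stmt-CriticalPhenomena-10269`, `…Theses.CardySelfRefinement.GradientComparability`).

The surgery around a pivotal axial bulk edge `e = {p, q}` is written in a **frame**
`V a b = p + a • u + b • w` (`u = ±e_d` along `e`, `w = ±e_{1-d}` across it, eight frames), so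
that one argument serves both orientations of `e`, both sides, and both ends:

* frame bookkeeping (`frame_adj`, `frame_ne`, `frame_neighbours`, `frame_coord_le`,
  `frame_dist_le`, `frame_segment_subset_interior`, `frame_edge_near`);
* drawings of explicit finite edge sets (`openEdgeUnion_singleton_eq`, `openEdgeUnion_insert_eq`,
  `isPreconnected_openEdgeUnion_insert`: a detour is a connected drawing);
* **level 1** (`level1`, registered sub-goal; output packaging `out_level1`): in the cell
  `p, q, q' = V 1 t, p' = V 0 t` beside `e` (`t = ±1`), with `p` linked in the non-crossing `σ` to
  `∂_{jp}Q` only and `q` to `∂_{jq}Q` only, unless `p'` is linked to `∂_{jq}Q` and `q'` to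
  `∂_{jp}Q` one of the admissible edges of the staple `f = {p,p'}`, `ê = {p',q'}`, `g = {q,q'}`
  is pivotal after closing `e` and opening the staple (surgery lemmas of `…BulkSurgery.lean`).
  The output records the closed set `Rm ∋ e`, the opened set `S ∋ e'`, that all are genuine edges
  within three steps of `p`, that the drawing of `S` is connected and contains the ends of `Rm`,
  and that `(σ ∖ Rm) ∪ (S ∖ {e'})` does not cross `Q`.

No percolation, no named fact.
-/

noncomputable section

namespace Summit.CriticalPhenomena.CardyFormulaZ2.Theorems.CardySelfRefinement

open scoped Topology
open Filter Set MeasureTheory Metric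
open Literature.Probability.LatticeModels Literature.Probability.Percolation
open Literature.Probability.Percolation.QuadCrossing
open Summit.CriticalPhenomena.CardyFormulaZ2.Theses.CardySelfRefinement

variable {D : Set ℂ} {δ : ℝ}


/-! ## Frames: the lattice around an edge, in the coordinates `V a b = p + a•u + b•w` -/

/-- Frame adjacency: unit steps in the frame are lattice edges. -/
theorem frame_adj {V : ℤ → ℤ → Site 2} {p u w : Site 2} (hV : ∀ a b, V a b = p + a • u + b • w)
    (hfr : ((u = ![1, 0] ∨ u = ![-1, 0]) ∧ (w = ![0, 1] ∨ w = ![0, -1])) ∨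
      ((u = ![0, 1] ∨ u = ![0, -1]) ∧ (w = ![1, 0] ∨ w = ![-1, 0])))
    {a b a' b' : ℤ}
    (h : (a' = a + 1 ∧ b' = b) ∨ (a' = a - 1 ∧ b' = b) ∨ (a' = a ∧ b' = b + 1) ∨ (a' = a ∧ b' = b - 1)) :
    (zdGraph 2).Adj (V a b) (V a' b') := by
  rw [hV, hV, zdGraph_two_adj_iff]
  rcases hfr with ⟨rfl | rfl, rfl | rfl⟩ | ⟨rfl | rfl, rfl | rfl⟩ <;>
    simp only [Pi.add_apply, Pi.smul_apply, smul_eq_mul, Matrix.cons_val_zero,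
      Matrix.cons_val_one, mul_one, mul_zero, mul_neg, add_zero] <;> omega

/-- Frame distinctness: distinct frame coordinates are distinct lattice points. -/
theorem frame_ne {V : ℤ → ℤ → Site 2} {p u w : Site 2} (hV : ∀ a b, V a b = p + a • u + b • w)
    (hfr : ((u = ![1, 0] ∨ u = ![-1, 0]) ∧ (w = ![0, 1] ∨ w = ![0, -1])) ∨
      ((u = ![0, 1] ∨ u = ![0, -1]) ∧ (w = ![1, 0] ∨ w = ![-1, 0])))
    {a b a' b' : ℤ} (h : a ≠ a' ∨ b ≠ b') : V a b ≠ V a' b' := by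
  rw [hV, hV]
  intro heq
  have h0 := congrFun heq 0
  have h1 := congrFun heq 1
  rcases hfr with ⟨rfl | rfl, rfl | rfl⟩ | ⟨rfl | rfl, rfl | rfl⟩ <;>
    simp only [Pi.add_apply, Pi.smul_apply, smul_eq_mul, Matrix.cons_val_zero,
      Matrix.cons_val_one, mul_one, mul_zero, mul_neg, add_zero] at h0 h1 <;> omega

/-- Frame neighbours: the lattice neighbours of a frame point are its four frame neighbours. -/
theorem frame_neighbours {V : ℤ → ℤ → Site 2} {p u w : Site 2}
    (hV : ∀ a b, V a b = p + a • u + b • w)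
    (hfr : ((u = ![1, 0] ∨ u = ![-1, 0]) ∧ (w = ![0, 1] ∨ w = ![0, -1])) ∨
      ((u = ![0, 1] ∨ u = ![0, -1]) ∧ (w = ![1, 0] ∨ w = ![-1, 0])))
    {a b : ℤ} {y : Site 2} (h : (zdGraph 2).Adj (V a b) y) :
    y = V (a + 1) b ∨ y = V (a - 1) b ∨ y = V a (b + 1) ∨ y = V a (b - 1) := by
  rw [hV, zdGraph_two_adj_iff] at h
  simp only [hV, Site.eq_iff_two]
  rcases hfr with ⟨rfl | rfl, rfl | rfl⟩ | ⟨rfl | rfl, rfl | rfl⟩ <;>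
    simp only [Pi.add_apply, Pi.smul_apply, smul_eq_mul, Matrix.cons_val_zero,
      Matrix.cons_val_one, mul_one, mul_zero, mul_neg, add_zero] at h ⊢ <;> omega

/-- Frame coordinates: `V a b` is within `|a| + |b|` of `p` in each coordinate. -/
theorem frame_coord_le {V : ℤ → ℤ → Site 2} {p u w : Site 2}
    (hV : ∀ a b, V a b = p + a • u + b • w)
    (hfr : ((u = ![1, 0] ∨ u = ![-1, 0]) ∧ (w = ![0, 1] ∨ w = ![0, -1])) ∨
      ((u = ![0, 1] ∨ u = ![0, -1]) ∧ (w = ![1, 0] ∨ w = ![-1, 0])))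
    (a b : ℤ) (i : Fin 2) : |V a b i - p i| ≤ |a| + |b| := by
  have h : V a b i - p i = a * u i + b * w i := by
    rw [hV]; simp only [Pi.add_apply, Pi.smul_apply, smul_eq_mul]; ring
  rw [h]
  rcases hfr with ⟨rfl | rfl, rfl | rfl⟩ | ⟨rfl | rfl, rfl | rfl⟩ <;> fin_cases i <;> simp

/-- Frame distances: `V a b` is drawn within `δ (|a| + |b|)` of the drawn `p`. -/
theorem frame_dist_le (hδ : 0 ≤ δ) {V : ℤ → ℤ → Site 2} {p u w : Site 2}
    (hV : ∀ a b, V a b = p + a • u + b • w)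
    (hfr : ((u = ![1, 0] ∨ u = ![-1, 0]) ∧ (w = ![0, 1] ∨ w = ![0, -1])) ∨
      ((u = ![0, 1] ∨ u = ![0, -1]) ∧ (w = ![1, 0] ∨ w = ![-1, 0])))
    (a b : ℤ) : dist (meshPoint δ (V a b)) (meshPoint δ p) ≤ δ * (|(a : ℝ)| + |(b : ℝ)|) := by
  have h0 : ((((V a b) 0 : ℤ)) : ℝ) - ((p 0 : ℤ) : ℝ) = a * u 0 + b * w 0 := by
    rw [hV]; push_cast [Pi.add_apply, Pi.smul_apply, smul_eq_mul]; ring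
  have h1 : ((((V a b) 1 : ℤ)) : ℝ) - ((p 1 : ℤ) : ℝ) = a * u 1 + b * w 1 := by
    rw [hV]; push_cast [Pi.add_apply, Pi.smul_apply, smul_eq_mul]; ring
  refine (dist_meshPoint_le hδ _ _).trans (le_of_eq ?_)
  rw [h0, h1]
  rcases hfr with ⟨rfl | rfl, rfl | rfl⟩ | ⟨rfl | rfl, rfl | rfl⟩ <;> simp [add_comm]

/-- In a frame whose `4δ`-ball around the drawn `p` lies in the interior of `[Q]`, the segment
between two frame points with `|a| + |b| ≤ 3` lies in the interior of `[Q]`. -/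
theorem frame_segment_subset_interior (hδ : 0 < δ) (Q : Quad D) {V : ℤ → ℤ → Site 2}
    {p u w : Site 2} (hV : ∀ a b, V a b = p + a • u + b • w)
    (hfr : ((u = ![1, 0] ∨ u = ![-1, 0]) ∧ (w = ![0, 1] ∨ w = ![0, -1])) ∨
      ((u = ![0, 1] ∨ u = ![0, -1]) ∧ (w = ![1, 0] ∨ w = ![-1, 0])))
    (hball : Metric.closedBall (meshPoint δ p) (4 * δ) ⊆ interior Q.carrier)
    {a b a' b' : ℤ} (h : |(a : ℝ)| + |(b : ℝ)| ≤ 4) (h' : |(a' : ℝ)| + |(b' : ℝ)| ≤ 4) :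
    segment ℝ (meshPoint δ (V a b)) (meshPoint δ (V a' b')) ⊆ interior Q.carrier := by
  refine ((convex_closedBall (meshPoint δ p) (4 * δ)).segment_subset ?_ ?_).trans hball
  · rw [Metric.mem_closedBall]
    exact (frame_dist_le hδ.le hV hfr a b).trans (by nlinarith)
  · rw [Metric.mem_closedBall]
    exact (frame_dist_le hδ.le hV hfr a' b').trans (by nlinarith)

/-- A genuine edge of the frame near `p` (the form in which the surgery reports its edges). -/
theorem frame_edge_near {V : ℤ → ℤ → Site 2} {p u w : Site 2}
    (hV : ∀ a b, V a b = p + a • u + b • w)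
    (hfr : ((u = ![1, 0] ∨ u = ![-1, 0]) ∧ (w = ![0, 1] ∨ w = ![0, -1])) ∨
      ((u = ![0, 1] ∨ u = ![0, -1]) ∧ (w = ![1, 0] ∨ w = ![-1, 0])))
    {a b a' b' : ℤ}
    (h : (a' = a + 1 ∧ b' = b) ∨ (a' = a - 1 ∧ b' = b) ∨ (a' = a ∧ b' = b + 1) ∨ (a' = a ∧ b' = b - 1))
    (hab : |a| + |b| ≤ 3) (hab' : |a'| + |b'| ≤ 3) :
    ∃ x y, s(V a b, V a' b') = s(x, y) ∧ (zdGraph 2).Adj x y ∧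
      ∀ i, |x i - p i| ≤ 3 ∧ |y i - p i| ≤ 3 :=
  ⟨V a b, V a' b', rfl, frame_adj hV hfr h, fun i =>
    ⟨(frame_coord_le hV hfr a b i).trans hab, (frame_coord_le hV hfr a' b' i).trans hab'⟩⟩

/-! ## Drawings of explicit finite edge sets -/

/-- The drawing of a single lattice edge is its segment. -/
theorem openEdgeUnion_singleton_eq (δ : ℝ) {a b : Site 2} (h : (zdGraph 2).Adj a b) :
    openEdgeUnion δ {s(a, b)} = segment ℝ (meshPoint δ a) (meshPoint δ b) :=
  (openEdgeUnion_singleton_subset δ a b).antisymm (segment_subset_openEdgeUnion' δ h rfl)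

/-- The drawing of `insert {a, b} S` is the segment of `{a, b}` plus the drawing of `S`. -/
theorem openEdgeUnion_insert_eq (δ : ℝ) {a b : Site 2} (h : (zdGraph 2).Adj a b)
    (S : BondConfig (Site 2)) :
    openEdgeUnion δ (insert s(a, b) S) = segment ℝ (meshPoint δ a) (meshPoint δ b) ∪ openEdgeUnion δ S := by
  rw [Set.insert_eq, openEdgeUnion_union, openEdgeUnion_singleton_eq δ h]

/-- An end of an open lattice edge is drawn in the drawing. -/
theorem meshPoint_mem_openEdgeUnion (δ : ℝ) {S : BondConfig (Site 2)} {b c : Site 2}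
    (h : (zdGraph 2).Adj b c) (hS : s(b, c) ∈ S) : meshPoint δ b ∈ openEdgeUnion δ S :=
  segment_subset_openEdgeUnion' δ h hS (left_mem_segment ℝ _ _)

/-- Growing a preconnected drawing by an edge attached to it. -/
theorem isPreconnected_openEdgeUnion_insert (δ : ℝ) {S : BondConfig (Site 2)} {a b : Site 2}
    (h : (zdGraph 2).Adj a b) (hb : meshPoint δ b ∈ openEdgeUnion δ S)
    (hS : IsPreconnected (openEdgeUnion δ S)) : IsPreconnected (openEdgeUnion δ (insert s(a, b) S)) := by
  rw [openEdgeUnion_insert_eq δ h]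
  exact IsPreconnected.union (meshPoint δ b) (right_mem_segment ℝ _ _) hb
    (convex_segment _ _).isPreconnected hS

/-! ## The local surgery: level 1 (the cell beside the pivotal edge) -/

/-- Output packaging for level 1: the staple `p → p' → q' → q` on side `t`. -/
theorem out_level1 (δ : ℝ) (Q : Quad D) {σ : BondConfig (Site 2)}
    {V : ℤ → ℤ → Site 2} {p u w : Site 2} (hV : ∀ a b, V a b = p + a • u + b • w)
    (hfr : ((u = ![1, 0] ∨ u = ![-1, 0]) ∧ (w = ![0, 1] ∨ w = ![0, -1])) ∨
      ((u = ![0, 1] ∨ u = ![0, -1]) ∧ (w = ![1, 0] ∨ w = ![-1, 0])))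
    {t : ℤ} (ht : t = 1 ∨ t = -1) {Adm : Sym2 (Site 2) → Prop} {e' : Sym2 (Site 2)}
    (he' : e' ∈ ({s(V 0 0, V 0 t), s(V 0 t, V 1 t), s(V 1 t, V 1 0)} : Set _)) (hA : Adm e')
    (hnc : ¬ ∃ a ∈ Q.side 0, ∃ b ∈ Q.side 2, JoinedIn (Q.carrier ∩ openEdgeUnion δ
      (σ \ {s(V 0 0, V 1 0)} ∪ (({s(V 0 0, V 0 t), s(V 0 t, V 1 t), s(V 1 t, V 1 0)} : Set _) \ {e'}))) a b) :
    ∃ (Rm S : Set (Sym2 (Site 2))) (e' : Sym2 (Site 2)), s(V 0 0, V 1 0) ∈ Rm ∧ e' ∈ S ∧ Adm e' ∧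
      (∀ r ∈ Rm ∪ S, ∃ x y, r = s(x, y) ∧ (zdGraph 2).Adj x y ∧
        ∀ i, |x i - p i| ≤ 3 ∧ |y i - p i| ≤ 3) ∧
      IsPreconnected (openEdgeUnion δ S) ∧ (∀ r ∈ Rm, ∀ x ∈ r, meshPoint δ x ∈ openEdgeUnion δ S) ∧
      ¬ ∃ a ∈ Q.side 0, ∃ b ∈ Q.side 2,
        JoinedIn (Q.carrier ∩ openEdgeUnion δ (σ \ Rm ∪ (S \ {e'}))) a b := by
  have ht1 : |t| ≤ 1 := by rcases ht with rfl | rfl <;> norm_num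
  have hf : (zdGraph 2).Adj (V 0 0) (V 0 t) :=
    frame_adj hV hfr (by rcases ht with rfl | rfl <;> norm_num)
  have hê : (zdGraph 2).Adj (V 0 t) (V 1 t) := frame_adj hV hfr (Or.inl ⟨by norm_num, rfl⟩)
  have hg : (zdGraph 2).Adj (V 1 t) (V 1 0) :=
    frame_adj hV hfr (by rcases ht with rfl | rfl <;> norm_num)
  refine ⟨{s(V 0 0, V 1 0)}, {s(V 0 0, V 0 t), s(V 0 t, V 1 t), s(V 1 t, V 1 0)}, e', rfl, he', hA,
    ?_, ?_, ?_, hnc⟩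
  · rintro r (hr | hr | hr | hr)
    · rw [Set.mem_singleton_iff.1 hr]
      exact frame_edge_near hV hfr (Or.inl ⟨by norm_num, rfl⟩) (by norm_num) (by norm_num)
    · rw [hr]
      exact frame_edge_near hV hfr (by rcases ht with rfl | rfl <;> norm_num) (by norm_num)
        (by norm_num; exact ht1.trans (by norm_num))
    · rw [hr]
      exact frame_edge_near hV hfr (Or.inl ⟨by norm_num, rfl⟩)
        (by norm_num; exact ht1.trans (by norm_num)) (by norm_num; omega)
    · rw [Set.mem_singleton_iff.1 hr]
      exact frame_edge_near hV hfr (by rcases ht with rfl | rfl <;> norm_num)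
        (by norm_num; omega) (by norm_num)
  · refine isPreconnected_openEdgeUnion_insert δ hf (meshPoint_mem_openEdgeUnion δ hê
      (Or.inl rfl)) (isPreconnected_openEdgeUnion_insert δ hê
        (meshPoint_mem_openEdgeUnion δ hg rfl) ?_)
    rw [openEdgeUnion_singleton_eq δ hg]
    exact (convex_segment _ _).isPreconnected
  · intro r hr x hx
    rw [Set.mem_singleton_iff.1 hr] at hx
    rcases Sym2.mem_iff.1 hx with rfl | rfl
    · exact meshPoint_mem_openEdgeUnion δ hf (Or.inl rfl)
    · refine meshPoint_mem_openEdgeUnion δ hg.symm (Or.inr (Or.inr ?_))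
      rw [Sym2.eq_swap]; rfl

/-- **Level 1.**  In the frame `V` (pivotal edge `e = {V 0 0, V 1 0}` closed, `V 0 0` linked in
`σ` to `∂_{jp}Q` only, `V 1 0` to `∂_{jq}Q` only, `σ` not crossing, the `4δ`-ball around the
drawn `p` inside the interior of `[Q]`), consider the cell on side `t = ±1` with the candidate
edges `ê = {V 0 t, V 1 t}`, `g = {V 1 0, V 1 t}` (admissible) and `f = {V 0 0, V 0 t}`
(admissible, or else `V 0 t` not linked to `∂_{jq}Q`).  Unless `V 0 t` is linked to `∂_{jq}Q`
and `V 1 t` to `∂_{jp}Q`, some admissible edge of the staple `f, ê, g` is pivotal after closing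
`e` and opening the staple. -/
theorem level1 {D : Set ℂ} {δ : ℝ} (hδ : 0 < δ) (Q : Quad D) {σ : BondConfig (Site 2)} {jp jq : Fin 4}
    (hj : (jp = 0 ∧ jq = 2) ∨ (jp = 2 ∧ jq = 0))
    (hσ : ¬ ∃ a ∈ Q.side 0, ∃ b ∈ Q.side 2, JoinedIn (Q.carrier ∩ openEdgeUnion δ σ) a b)
    {V : ℤ → ℤ → Site 2} {p u w : Site 2} (hV : ∀ a b, V a b = p + a • u + b • w)
    (hfr : ((u = ![1, 0] ∨ u = ![-1, 0]) ∧ (w = ![0, 1] ∨ w = ![0, -1])) ∨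
      ((u = ![0, 1] ∨ u = ![0, -1]) ∧ (w = ![1, 0] ∨ w = ![-1, 0])))
    (hball : Metric.closedBall (meshPoint δ p) (4 * δ) ⊆ interior Q.carrier)
    (hpL : ∃ a ∈ Q.side jp, JoinedIn (Q.carrier ∩ openEdgeUnion δ σ) a (meshPoint δ (V 0 0)))
    (hpR : ¬ ∃ b ∈ Q.side jq, JoinedIn (Q.carrier ∩ openEdgeUnion δ σ) b (meshPoint δ (V 0 0)))
    (hqR : ∃ b ∈ Q.side jq, JoinedIn (Q.carrier ∩ openEdgeUnion δ σ) b (meshPoint δ (V 1 0)))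
    (hqL : ¬ ∃ a ∈ Q.side jp, JoinedIn (Q.carrier ∩ openEdgeUnion δ σ) a (meshPoint δ (V 1 0)))
    {t : ℤ} (ht : t = 1 ∨ t = -1) {Adm : Sym2 (Site 2) → Prop}
    (hAê : Adm s(V 0 t, V 1 t)) (hAg : Adm s(V 1 0, V 1 t))
    (hAf : Adm s(V 0 0, V 0 t) ∨
      ¬ ∃ b ∈ Q.side jq, JoinedIn (Q.carrier ∩ openEdgeUnion δ σ) b (meshPoint δ (V 0 t)))
    (hfail : ¬ ((∃ b ∈ Q.side jq, JoinedIn (Q.carrier ∩ openEdgeUnion δ σ) b (meshPoint δ (V 0 t))) ∧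
      ∃ a ∈ Q.side jp, JoinedIn (Q.carrier ∩ openEdgeUnion δ σ) a (meshPoint δ (V 1 t)))) :
    ∃ (Rm S : Set (Sym2 (Site 2))) (e' : Sym2 (Site 2)), s(V 0 0, V 1 0) ∈ Rm ∧ e' ∈ S ∧ Adm e' ∧
      (∀ r ∈ Rm ∪ S, ∃ x y, r = s(x, y) ∧ (zdGraph 2).Adj x y ∧
        ∀ i, |x i - p i| ≤ 3 ∧ |y i - p i| ≤ 3) ∧
      IsPreconnected (openEdgeUnion δ S) ∧ (∀ r ∈ Rm, ∀ x ∈ r, meshPoint δ x ∈ openEdgeUnion δ S) ∧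
      ¬ ∃ a ∈ Q.side 0, ∃ b ∈ Q.side 2,
        JoinedIn (Q.carrier ∩ openEdgeUnion δ (σ \ Rm ∪ (S \ {e'}))) a b := by
  have hj' : (jq = 0 ∧ jp = 2) ∨ (jq = 2 ∧ jp = 0) := by
    rcases hj with ⟨h1, h2⟩ | ⟨h1, h2⟩
    exacts [Or.inr ⟨h2, h1⟩, Or.inl ⟨h2, h1⟩]
  have ht1 : |(t : ℝ)| ≤ 1 := by rcases ht with rfl | rfl <;> norm_num
  have hσ' : ¬ ∃ a ∈ Q.side 0, ∃ b ∈ Q.side 2,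
      JoinedIn (Q.carrier ∩ openEdgeUnion δ (σ \ {s(V 0 0, V 1 0)})) a b :=
    fun ⟨a, ha, b, hb, hJ⟩ => hσ ⟨a, ha, b, hb, joinedIn_mono_config δ Q Set.sdiff_subset hJ⟩
  -- interior: every segment between frame points of weight ≤ 2
  have hI : ∀ a b a' b' : ℤ, |(a : ℝ)| + |(b : ℝ)| ≤ 4 → |(a' : ℝ)| + |(b' : ℝ)| ≤ 4 →
      segment ℝ (meshPoint δ (V a b)) (meshPoint δ (V a' b')) ⊆ interior Q.carrier :=
    fun a b a' b' h h' => frame_segment_subset_interior hδ Q hV hfr hball h h'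
  have h00 : |((0 : ℤ) : ℝ)| + |((0 : ℤ) : ℝ)| ≤ 4 := by norm_num
  have h10 : |((1 : ℤ) : ℝ)| + |((0 : ℤ) : ℝ)| ≤ 4 := by norm_num
  have h0t : |((0 : ℤ) : ℝ)| + |(t : ℝ)| ≤ 4 := by norm_num; linarith
  have h1t : |((1 : ℤ) : ℝ)| + |(t : ℝ)| ≤ 4 := by norm_num; linarith
  have hf : (zdGraph 2).Adj (V 0 0) (V 0 t) :=
    frame_adj hV hfr (by rcases ht with rfl | rfl <;> norm_num)
  have hg : (zdGraph 2).Adj (V 1 0) (V 1 t) :=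
    frame_adj hV hfr (by rcases ht with rfl | rfl <;> norm_num)
  by_cases h1 : ∃ b ∈ Q.side jq, JoinedIn (Q.carrier ∩ openEdgeUnion δ σ) b (meshPoint δ (V 0 t))
  · -- `V 0 t` is linked to `∂_{jq}Q`: the post `f` works
    have hA : Adm s(V 0 0, V 0 t) := hAf.resolve_right (fun h => h h1)
    have h2 : ¬ ∃ a ∈ Q.side jp, JoinedIn (Q.carrier ∩ openEdgeUnion δ σ) a (meshPoint δ (V 1 t)) :=
      fun h => hfail ⟨h1, h⟩
    have h3 : ¬ ∃ a ∈ Q.side jp, JoinedIn (Q.carrier ∩ openEdgeUnion δ σ) a (meshPoint δ (V 0 t)) :=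
      fun h => hσ (crossing_of_two_links Q hj h h1)
    have key := not_crossing_staple_end hδ Q hj' hσ (p := V 1 0) (p' := V 1 t) (q' := V 0 t)
      (openEdgeUnion_subset_of_forall fun x y _ hxy => by
        rcases hxy with h | h
        · rw [segment_meshPoint_eq_of_sym2_eq δ h]; exact hI _ _ _ _ h10 h1t
        · rw [segment_meshPoint_eq_of_sym2_eq δ (Set.mem_singleton_iff.1 h)]; exact hI _ _ _ _ h1t h0t)
      hqL h2 h3
    refine out_level1 δ Q hV hfr ht (Or.inl rfl) hA fun ⟨a, ha, b, hb, hJ⟩ =>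
      key ⟨a, ha, b, hb, joinedIn_mono_config δ Q ?_ hJ⟩
    rintro x (hx | ⟨hx | hx | hx, hne⟩)
    · exact Or.inl (Or.inl hx.1)
    · exact absurd hx hne
    · refine Or.inl (Or.inr (Or.inr ?_)); rw [hx, Sym2.eq_swap]; rfl
    · refine Or.inl (Or.inr (Or.inl ?_)); rw [Set.mem_singleton_iff.1 hx, Sym2.eq_swap]
  · by_cases h2 : ∃ b ∈ Q.side jq, JoinedIn (Q.carrier ∩ openEdgeUnion δ σ) b (meshPoint δ (V 1 t))
    · -- `V 1 t` linked to `∂_{jq}Q`, `V 0 t` not: the rail `ê` works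
      have h3 : ¬ ∃ a ∈ Q.side jp, JoinedIn (Q.carrier ∩ openEdgeUnion δ σ) a (meshPoint δ (V 1 t)) :=
        fun h => hσ (crossing_of_two_links Q hj h h2)
      have key := not_crossing_staple_mid hδ Q hj hσ hf hg
        (frame_ne hV hfr (Or.inl (by norm_num))) (frame_ne hV hfr (Or.inl (by norm_num)))
        (frame_ne hV hfr (Or.inl (by norm_num))) (frame_ne hV hfr (Or.inl (by norm_num)))
        (openEdgeUnion_subset_of_forall fun x y _ hxy => by
          rcases hxy with h | h
          · rw [segment_meshPoint_eq_of_sym2_eq δ h]; exact hI _ _ _ _ h00 h0t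
          · rw [segment_meshPoint_eq_of_sym2_eq δ (Set.mem_singleton_iff.1 h)]; exact hI _ _ _ _ h10 h1t)
        hpL hpR hqR hqL h1 h3 (fun hJ => h1 (link_of_joinedIn h2 hJ.symm))
      refine out_level1 δ Q hV hfr ht (Or.inr (Or.inl rfl)) hAê fun ⟨a, ha, b, hb, hJ⟩ =>
        key ⟨a, ha, b, hb, joinedIn_mono_config δ Q ?_ hJ⟩
      rintro x (hx | ⟨hx | hx | hx, hne⟩)
      · exact Or.inl (Or.inl hx.1)
      · exact Or.inl (Or.inr hx)
      · exact absurd hx hne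
      · refine Or.inr ?_; rw [Set.mem_singleton_iff.1 hx, Sym2.eq_swap]; rfl
    · -- neither linked to `∂_{jq}Q`: the post `g` works
      have key := not_crossing_staple_end hδ Q hj hσ (p := V 0 0) (p' := V 0 t) (q' := V 1 t)
        (openEdgeUnion_subset_of_forall fun x y _ hxy => by
          rcases hxy with h | h
          · rw [segment_meshPoint_eq_of_sym2_eq δ h]; exact hI _ _ _ _ h00 h0t
          · rw [segment_meshPoint_eq_of_sym2_eq δ (Set.mem_singleton_iff.1 h)]; exact hI _ _ _ _ h0t h1t)
        hpR h1 h2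
      have hA : Adm s(V 1 t, V 1 0) := by rw [Sym2.eq_swap]; exact hAg
      refine out_level1 δ Q hV hfr ht (Or.inr (Or.inr rfl)) hA fun ⟨a, ha, b, hb, hJ⟩ =>
        key ⟨a, ha, b, hb, joinedIn_mono_config δ Q ?_ hJ⟩
      rintro x (hx | ⟨hx | hx | hx, hne⟩)
      · exact Or.inl (Or.inl hx.1)
      · exact Or.inl (Or.inr (Or.inl hx))
      · exact Or.inl (Or.inr (Or.inr hx))
      · exact absurd hx hne

end Summit.CriticalPhenomena.CardyFormulaZ2.Theorems.CardySelfRefinement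

end
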